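import Summits.HubbardSuperconductivity.HubbardSuperconductivity.Theorems.NodalWardXYNodalReductionDefs
import Summits.HubbardSuperconductivity.HubbardSuperconductivity.Theorems.ThermalWedgeTwApproximatingHamiltonianLocality

/-!
# Order-square lower bound: crux `NodalReduction` (stmt-HubbardSuperconductivity-1268), line `Sketch`, stub `stub_orderSqLower`

Statement (C) `OrderSqLower` of `NodalWardXYNodalReductionDefs`: for the `d`-wave pair field
`Δ = pairField dWaveFormFactor L` on the Hubbard torus `(ℤ/Lℤ)²`, the order operator `O = Δ + Δᴴ` and a
unit vector `Φ` with `⟨Φ, Δ²Φ⟩ = 0 = ⟨Φ, Δᴴ²Φ⟩` (the `U(1)` selection rules of a particle-number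
eigenvector, supplied elsewhere), the pair long-range order controls `‖OΦ‖²` from below:
`2 Re⟨Φ, ΔᴴΔ Φ⟩ - C₁ L² ≤ ‖OΦ‖²` with `C₁` independent of `L` (Koma–Tasaki, J. Stat. Phys. 76 (1994)
745, proof of Thm 2.2, the step converting LRO into the gain of the trial state).

Content (four lines of linear algebra plus one landed locality estimate):

* `‖OΦ‖² = ⟨OΦ, OΦ⟩ = ⟨Φ, O²Φ⟩` since `O` is Hermitian (`isHermitian_pairField_add_conjTranspose`;
  `osl_star_mulVec_dotProduct_mulVec_self`);
* `O² = Δ² + ΔΔᴴ + ΔᴴΔ + Δᴴ²`, and the `Δ²`, `Δᴴ²` expectations vanish by hypothesis;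
* `ΔΔᴴ = ΔᴴΔ + [Δ, Δᴴ]` and `Re⟨Φ, XΦ⟩ ≥ -‖X‖` for unit `Φ` (Cauchy–Schwarz in the `L²` operator norm,
  tree: `norm_star_dotProduct_mulVec_le` of `TraceInequalitiesProofs`);
* graded locality: `‖[Δ, Δᴴ]‖ ≤ 25 · 2‖P‖² · L²`, `‖P‖ = 2 Σ_e |d e/√2|`, because the local pair `P_x` is an
  even element of the CAR algebra of its `≤ 5` sites and commutes with every `P_yᴴ` of disjoint support,
  which excludes at most `25` values of `y` (tree: `twAhm_norm_comm_pairField_conjTranspose_le` of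
  `Theorems/ThermalWedgeTwApproximatingHamiltonianLocality.lean`; Bratteli–Robinson II §5.2.2).

Hence `C₁ = 25 · 2 (2 Σ_e |d e/√2|)²`.

Sources: T. Koma, H. Tasaki, J. Stat. Phys. 76 (1994) 745, proof of Thm 2.2; T. Koma, H. Tasaki, Commun.
Math. Phys. 158 (1993) 191, Thm 7.1; O. Bratteli, D. W. Robinson, *Operator Algebras and Quantum
Statistical Mechanics II*, §5.2.2. Design: no definitions; the two generic `dotProduct` identities are
stated for an arbitrary finite index type, the torus enters only through the landed norm bound.
-/

noncomputable section

-- `Summit.HubbardSuperconductivity.HubbardSuperconductivity.…` is the tree's summit/sub-problem namespace (D-0017).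
set_option linter.dupNamespace false

namespace Summit.HubbardSuperconductivity.HubbardSuperconductivity.Theorems.NodalReduction

open Matrix Finset
open Literature.MathematicalPhysics.QuantumLattice Literature.Probability.LatticeModels
open scoped Matrix.Norms.L2Operator ComplexOrder

/-- `⟨MΦ, MΦ⟩ = ⟨Φ, M²Φ⟩` for a Hermitian matrix `M` (`star (Mψ) ⬝ᵥ (Mψ) = star ψ ⬝ᵥ (MᴴM)ψ`, `Mᴴ = M`). -/
theorem osl_star_mulVec_dotProduct_mulVec_self {n : Type*} [Fintype n] {M : Matrix n n ℂ}
    (hM : M.IsHermitian) (ψ : n → ℂ) :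
    star (M *ᵥ ψ) ⬝ᵥ (M *ᵥ ψ) = star ψ ⬝ᵥ ((M * M) *ᵥ ψ) := by
  rw [star_mulVec, ← dotProduct_mulVec, mulVec_mulVec, hM.eq]

/-- `-‖X‖ ≤ Re⟨Φ, XΦ⟩` for a unit vector `Φ` (`L²` operator norm; Cauchy–Schwarz applied to `-X`). -/
theorem osl_neg_norm_le_re_star_dotProduct_mulVec {n : Type*} [Fintype n] [DecidableEq n] {Φ : n → ℂ}
    (hΦ : star Φ ⬝ᵥ Φ = 1) (X : Matrix n n ℂ) : -‖X‖ ≤ (star Φ ⬝ᵥ (X *ᵥ Φ)).re := by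
  have h := (Complex.re_le_norm _).trans (norm_star_dotProduct_mulVec_le (-X) Φ)
  rw [hΦ, Complex.one_re, mul_one, neg_mulVec, dotProduct_neg, Complex.neg_re, norm_neg] at h
  linarith

/-- The expectation of `O² = (D + Dᴴ)²` when the charge-`∓4` parts `⟨Φ, D²Φ⟩`, `⟨Φ, Dᴴ²Φ⟩` vanish:
`⟨Φ, O²Φ⟩ = ⟨Φ, DᴴD Φ⟩ + ⟨Φ, [D, Dᴴ] Φ⟩ + ⟨Φ, DᴴD Φ⟩` (`DDᴴ = DᴴD + [D, Dᴴ]`). -/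
theorem osl_form_sq_eq {n : Type*} [Fintype n] (D : Matrix n n ℂ) {Φ : n → ℂ}
    (h1 : star Φ ⬝ᵥ ((D * D) *ᵥ Φ) = 0) (h2 : star Φ ⬝ᵥ ((Dᴴ * Dᴴ) *ᵥ Φ) = 0) :
    star Φ ⬝ᵥ (((D + Dᴴ) * (D + Dᴴ)) *ᵥ Φ) =
      star Φ ⬝ᵥ ((Dᴴ * D) *ᵥ Φ) + star Φ ⬝ᵥ ((D * Dᴴ - Dᴴ * D) *ᵥ Φ) +
        star Φ ⬝ᵥ ((Dᴴ * D) *ᵥ Φ) := by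
  have hf : star Φ ⬝ᵥ ((D * Dᴴ) *ᵥ Φ) =
      star Φ ⬝ᵥ ((Dᴴ * D) *ᵥ Φ) + star Φ ⬝ᵥ ((D * Dᴴ - Dᴴ * D) *ᵥ Φ) := by
    rw [← dotProduct_add, ← add_mulVec, add_sub_cancel]
  rw [add_mul, mul_add, mul_add, add_mulVec, add_mulVec, add_mulVec, dotProduct_add, dotProduct_add,
    dotProduct_add, h1, h2, zero_add, add_zero, hf]

/-- **(C) `OrderSqLower`**: `2 Re⟨Φ, ΔᴴΔ Φ⟩ - C₁ L² ≤ ‖OΦ‖²` for unit `Φ` with vanishing `⟨Φ, Δ²Φ⟩`,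
`⟨Φ, Δᴴ²Φ⟩`, where `O = Δ + Δᴴ`, `Δ = pairField dWaveFormFactor L`, with
`C₁ = 25 · 2 (2 Σ_e |d e/√2|)²` (Koma–Tasaki 1994, proof of Thm 2.2): `‖OΦ‖² = ⟨Φ, O²Φ⟩ =
2⟨Φ, ΔᴴΔΦ⟩ + ⟨Φ, [Δ,Δᴴ]Φ⟩ ≥ 2 Re⟨Φ, ΔᴴΔΦ⟩ - ‖[Δ,Δᴴ]‖` and the graded-locality bound
`twAhm_norm_comm_pairField_conjTranspose_le`. -/
theorem stub_orderSqLower : OrderSqLower := by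
  refine ⟨25 * (2 * (2 * ∑ e ∈ insert (0 : Site 2) unitSteps, |dWaveFormFactor e / Real.sqrt 2|) ^ 2),
    fun L _ Φ hΦ h1 h2 => ?_⟩
  dsimp only
  rw [osl_star_mulVec_dotProduct_mulVec_self (isHermitian_pairField_add_conjTranspose L),
    osl_form_sq_eq (pairField dWaveFormFactor L) h1 h2, Complex.add_re, Complex.add_re]
  have hC := osl_neg_norm_le_re_star_dotProduct_mulVec hΦ
    (pairField dWaveFormFactor L * (pairField dWaveFormFactor L)ᴴ -
      (pairField dWaveFormFactor L)ᴴ * pairField dWaveFormFactor L)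
  have hN := twAhm_norm_comm_pairField_conjTranspose_le L dWaveFormFactor
  linarith

end Summit.HubbardSuperconductivity.HubbardSuperconductivity.Theorems.NodalReduction

end
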